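import Summits.Ventures.CertifiedManyBodySolver.Theorems.ThermalStiffnessCeilingU8b8_le_7o44.Negative.CurrentCovarianceLocality
import Literature.LinearAlgebra.Matrix.GradedCompression
import HarnessLib

/-!
# Local charge pinching of even local observables (negative-side helper for the cruxes K1′ / K1 of route `TcThermcert1`)

Disprover's helper (`--supports stmt-Ventures-24560`; crux K1′ `TcThermcert1.ThermalStiffnessCeilingU8b8_le_7o44`, line of record
`Cruxes/ThermalStiffnessCeilingU8b8_le_7o44/Lines/gauge_qbp_far_seam.lean` v1.6, bet C8 `stub_currentClustering8`; equally the K1 twin's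
C10): the generic half of finding F9 of edition 4 of `Cruxes/ThermalStiffnessCeilingU8b8_le_7o44/Disproof.lean` — the torus corollary
("`SectorPreserving` is redundant in Hypothesis C") is `CurrentClusteringSectorFree.lean`. Companion of `CurrentCovarianceTRBlind.lean`
(F1), `CurrentCovarianceLocality.lean` (F4), `CurrentCovarianceNonVacuity.lean` (F5).

THE PINCHING. For a site window `X ⊆ Λ` grade the occupation configurations `s` by their LOCAL charges
`ℓ_X(s) = (N↑_X(s), N↓_X(s)) = (|upPart s ∩ X|, |downPart s ∩ X|)` and let `A₀ = gradedCompress ℓ_X A = Σ_q Π_q A Π_q`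
(`Literature.LinearAlgebra.Matrix.gradedCompress`: the trace-preserving conditional expectation onto the block-diagonal algebra of the
grading, Petz §9.2 — here onto the commutant of the local charges `N↑_X`, `N↓_X` = the local `U(1)×U(1)` gauge-invariant observables).
For `A` in the CAR subalgebra `𝔄(orbSet X)`:
* LOCALITY (F4's `apply_eq_zero_of_mem_carSubalgebra`: `A s t ≠ 0 ⇒ s ∖ orbSet X = t ∖ orbSet X`) ⇒ global and local charge
  differences of `s`, `t` agree (`card_upPart_eq_iff_of_apply_ne_zero`); hence `A₀` CONSERVES the global `(N↑, N↓)`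
  (`preservesSectors_locPinch`) and INSIDE every global `(N↑, N↓)` sector `A₀` and `A` have the same matrix elements
  (`locPinch_apply_of_card_eq`): the line's sector blocks of `A₀`, `A` and of `A₀·J`, `A·J` (`J` sector preserving) coincide
  (`toBlock_locPinch_eq`, `toBlock_locPinch_mul_eq`);
* the local sector projections `Π_(a,b) = 1[N↑_X = a]·1[N↓_X = b]`, `1[N^σ_X = a] = Σ_{T ⊆ X, |T| = a} Π_{x∈T} n_{xσ} Π_{x∈X∖T}(1 − n_{xσ})`,
  are polynomials in densities of `X` (`diagonal_spinCount_indicator_mem`, `sectorProj_locGrade_mem`; proved in the commutative algebra of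
  diagonal symbols and pushed forward along `Matrix.diagonalAlgHom`), so `A ∈ 𝔄_even(orbSet X) ⇒ A₀ ∈ 𝔄_even(orbSet X)` (`locPinch_mem`);
* at most `(|X|+1)²` local sectors occur and `‖Π_q‖ ≤ 1`, so `‖A₀‖ ≤ (|X|+1)² ‖A‖` (`norm_locPinch_le`, crude but sufficient);
* an even observable of the EMPTY window is a scalar (`exists_mul_eq_smul_of_mem_carEvenSubalgebra_orbSet_empty`).

HONEST FRAMING: finite-dimensional folklore (conditional expectations onto gauge-invariant local algebras); NO KILL of K1′, of stub B or of
the bet C8 is claimed, nothing here bears on clustering at `(U, n, β) = (8, 7/8, 8)`, and superconductivity in the Hubbard model is neither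
proved nor disproved by anything in this file.
-/

noncomputable section

open scoped ComplexOrder ComplexConjugate Matrix.Norms.L2Operator
open Filter Topology Matrix Finset
open Literature.MathematicalPhysics.QuantumLattice
open Literature.Probability.LatticeModels
open Summit.Ventures.CertifiedManyBodySolver.Theorems.TcThermcert1.GaugeQbpFarSeam
open Summit.Ventures.CertifiedManyBodySolver.Theorems.TcThermcert1.CurrentCovarianceTRBlind
open Summit.Ventures.CertifiedManyBodySolver.Theorems.TcThermcert1.CurrentCovarianceLocality
open Literature.LinearAlgebra.Matrix (gradedCompress gradedCompress_apply gradedCompress_eq_sum_sectorProj)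

namespace Summit.Ventures.CertifiedManyBodySolver.Theorems.TcThermcert1.LocalChargePinching

/-! Throughout, the LOCAL charge grading of a site window `X` is the map `s ↦ ℓ_X(s) = ((upPart s ∩ X).card, (downPart s ∩ X).card)`
(numbers of up / down electrons of `s` on sites of `X`), written out in full in every statement. -/

/-! ## §1 Counting: the line's sector predicate and locality of the charge bookkeeping -/

section Generic

variable {Λ : Type*} [LinearOrder Λ] [Fintype Λ]

/-- The spin-`0` orbitals of a configuration are its up electrons (counted on sites). [folklore] -/
theorem card_filter_spin_zero_eq (s : Finset (Orb Λ)) :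
    (s.filter fun i => (ofLex i).2 = 0).card = (upPart s).card := by
  rw [show (s.filter fun i => (ofLex i).2 = 0) = (upPart s).image (fun x => orb x 0) from ?_,
    Finset.card_image_of_injective _ (fun x y h => (orb_inj.1 h).1)]
  ext i
  simp only [Finset.mem_filter, Finset.mem_image, mem_upPart]
  constructor
  · rintro ⟨hi, h0⟩
    refine ⟨(ofLex i).1, ?_, ?_⟩ <;>
    · have : orb (ofLex i).1 0 = i := by rw [← h0]; exact toLex_ofLex i
      simp [this, hi]
  · rintro ⟨x, hx, rfl⟩
    exact ⟨hx, rfl⟩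

/-- The line's `(N = 2M, S^z = 0)` coordinate-sector predicate says `(N↑, N↓) = (M, M)`. [folklore] -/
theorem sector_iff (M : ℕ) (s : Finset (Orb Λ)) :
    (s.card = 2 * M ∧ 2 * (s.filter fun i => (ofLex i).2 = 0).card = 2 * M) ↔
      ((upPart s).card = M ∧ (downPart s).card = M) := by
  rw [card_filter_spin_zero_eq, card_eq_upPart_add_downPart s]
  omega

/-- The up electrons OUTSIDE the window `X` are read off `s ∖ orbSet X`. [folklore] -/
theorem upPart_sdiff_eq_of_sdiff_eq (X : Finset Λ) {s t : Finset (Orb Λ)} (h : s \ orbSet X = t \ orbSet X) :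
    upPart s \ X = upPart t \ X := by
  have key : ∀ {s t : Finset (Orb Λ)}, s \ orbSet X = t \ orbSet X → upPart s \ X ⊆ upPart t \ X := by
    intro s t h x hx
    rw [Finset.mem_sdiff, mem_upPart] at hx ⊢
    have hm : orb x 0 ∈ s \ orbSet X :=
      Finset.mem_sdiff.2 ⟨hx.1, fun h' => hx.2 (by rw [mem_orbSet] at h'; exact h')⟩
    rw [h, Finset.mem_sdiff] at hm
    exact ⟨hm.1, hx.2⟩
  exact Finset.Subset.antisymm (key h) (key h.symm)

/-- The down electrons OUTSIDE the window `X` are read off `s ∖ orbSet X`. [folklore] -/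
theorem downPart_sdiff_eq_of_sdiff_eq (X : Finset Λ) {s t : Finset (Orb Λ)} (h : s \ orbSet X = t \ orbSet X) :
    downPart s \ X = downPart t \ X := by
  have key : ∀ {s t : Finset (Orb Λ)}, s \ orbSet X = t \ orbSet X → downPart s \ X ⊆ downPart t \ X := by
    intro s t h x hx
    rw [Finset.mem_sdiff, mem_downPart] at hx ⊢
    have hm : orb x 1 ∈ s \ orbSet X :=
      Finset.mem_sdiff.2 ⟨hx.1, fun h' => hx.2 (by rw [mem_orbSet] at h'; exact h')⟩
    rw [h, Finset.mem_sdiff] at hm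
    exact ⟨hm.1, hx.2⟩
  exact Finset.Subset.antisymm (key h) (key h.symm)

/-- **Locality of the charge bookkeeping**: for `A ∈ 𝔄(orbSet X)` and `A s t ≠ 0` the configurations `s`, `t` agree outside the
window (`apply_eq_zero_of_mem_carSubalgebra`), so their GLOBAL up (down) numbers agree iff their LOCAL ones inside `X` do. [folklore] -/
theorem card_upPart_eq_iff_of_apply_ne_zero {X : Finset Λ} {A : Matrix (Finset (Orb Λ)) (Finset (Orb Λ)) ℂ}
    (hA : A ∈ carSubalgebra (orbSet X)) {s t : Finset (Orb Λ)} (h : A s t ≠ 0) :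
    ((upPart s).card = (upPart t).card ↔ (upPart s ∩ X).card = (upPart t ∩ X).card) ∧
      ((downPart s).card = (downPart t).card ↔ (downPart s ∩ X).card = (downPart t ∩ X).card) := by
  have hst : s \ orbSet X = t \ orbSet X := by
    by_contra hne
    exact h (apply_eq_zero_of_mem_carSubalgebra hA hne)
  have hu := upPart_sdiff_eq_of_sdiff_eq X hst
  have hd := downPart_sdiff_eq_of_sdiff_eq X hst
  rw [← Finset.card_inter_add_card_sdiff (upPart s) X, ← Finset.card_inter_add_card_sdiff (upPart t) X, hu,
    ← Finset.card_inter_add_card_sdiff (downPart s) X, ← Finset.card_inter_add_card_sdiff (downPart t) X, hd]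
  omega

/-! ## §2 The local pinching `A ↦ A₀ = Σ_q Π_q A Π_q` along `ℓ_X` -/

/-- **`A₀` conserves the global `(N↑, N↓)`** for `A ∈ 𝔄(orbSet X)`. [folklore] -/
theorem preservesSectors_locPinch {X : Finset Λ} {A : Matrix (Finset (Orb Λ)) (Finset (Orb Λ)) ℂ}
    (hA : A ∈ carSubalgebra (orbSet X)) : PreservesSectors (gradedCompress (fun s : Finset (Orb Λ) => ((upPart s ∩ X).card, (downPart s ∩ X).card)) A) := by
  intro s t hst
  simp only [gradedCompress_apply] at hst
  split_ifs at hst with hg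
  · obtain ⟨hg1, hg2⟩ := Prod.mk.inj hg
    have hc := card_upPart_eq_iff_of_apply_ne_zero hA hst
    exact ⟨hc.1.2 hg1, hc.2.2 hg2⟩
  · exact absurd rfl hst

/-- **Inside a global `(N↑, N↓)` sector `A₀` and `A` have the same matrix elements** (`A ∈ 𝔄(orbSet X)`). [folklore] -/
theorem locPinch_apply_of_card_eq {X : Finset Λ} {A : Matrix (Finset (Orb Λ)) (Finset (Orb Λ)) ℂ}
    (hA : A ∈ carSubalgebra (orbSet X)) {s t : Finset (Orb Λ)}
    (hu : (upPart s).card = (upPart t).card) (hd : (downPart s).card = (downPart t).card) :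
    gradedCompress (fun s : Finset (Orb Λ) => ((upPart s ∩ X).card, (downPart s ∩ X).card)) A s t = A s t := by
  simp only [gradedCompress_apply]
  split_ifs with hg
  · rfl
  · by_contra h0
    have hc := card_upPart_eq_iff_of_apply_ne_zero hA (Ne.symm h0)
    exact hg (Prod.ext (hc.1.1 hu) (hc.2.1 hd))

/-- **The sector blocks of `A₀` and `A` coincide** on the line's `(N = 2M, S^z = 0)` sector. [folklore] -/
theorem toBlock_locPinch_eq {X : Finset Λ} {A : Matrix (Finset (Orb Λ)) (Finset (Orb Λ)) ℂ}
    (hA : A ∈ carSubalgebra (orbSet X)) (M : ℕ) :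
    (gradedCompress (fun s : Finset (Orb Λ) => ((upPart s ∩ X).card, (downPart s ∩ X).card)) A).toBlock
        (fun s => s.card = 2 * M ∧ 2 * (s.filter fun i => (ofLex i).2 = 0).card = 2 * M)
        (fun s => s.card = 2 * M ∧ 2 * (s.filter fun i => (ofLex i).2 = 0).card = 2 * M) =
      A.toBlock (fun s => s.card = 2 * M ∧ 2 * (s.filter fun i => (ofLex i).2 = 0).card = 2 * M)
        (fun s => s.card = 2 * M ∧ 2 * (s.filter fun i => (ofLex i).2 = 0).card = 2 * M) := by
  ext ⟨s, hs⟩ ⟨t, ht⟩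
  rw [toBlock_apply, toBlock_apply]
  have hs' := (sector_iff M s).1 hs
  have ht' := (sector_iff M t).1 ht
  exact locPinch_apply_of_card_eq hA (hs'.1.trans ht'.1.symm) (hs'.2.trans ht'.2.symm)

/-- **The sector blocks of `A₀·J` and `A·J` coincide** for every `J` with no entry between the sector and its complement
(the line's `SectorPreserving`, e.g. the bond current). [folklore] -/
theorem toBlock_locPinch_mul_eq {X : Finset Λ} {A : Matrix (Finset (Orb Λ)) (Finset (Orb Λ)) ℂ}
    (hA : A ∈ carSubalgebra (orbSet X)) (M : ℕ) {J : Matrix (Finset (Orb Λ)) (Finset (Orb Λ)) ℂ}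
    (hJ : ∀ s t : Finset (Orb Λ),
      (s.card = 2 * M ∧ 2 * (s.filter fun i => (ofLex i).2 = 0).card = 2 * M) →
      ¬ (t.card = 2 * M ∧ 2 * (t.filter fun i => (ofLex i).2 = 0).card = 2 * M) →
      J s t = 0 ∧ J t s = 0) :
    (gradedCompress (fun s : Finset (Orb Λ) => ((upPart s ∩ X).card, (downPart s ∩ X).card)) A * J).toBlock
        (fun s => s.card = 2 * M ∧ 2 * (s.filter fun i => (ofLex i).2 = 0).card = 2 * M)
        (fun s => s.card = 2 * M ∧ 2 * (s.filter fun i => (ofLex i).2 = 0).card = 2 * M) =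
      (A * J).toBlock (fun s => s.card = 2 * M ∧ 2 * (s.filter fun i => (ofLex i).2 = 0).card = 2 * M)
        (fun s => s.card = 2 * M ∧ 2 * (s.filter fun i => (ofLex i).2 = 0).card = 2 * M) := by
  ext ⟨s, hs⟩ ⟨t, ht⟩
  rw [toBlock_apply, toBlock_apply, mul_apply, mul_apply]
  refine Finset.sum_congr rfl fun u _ => ?_
  by_cases hu : u.card = 2 * M ∧ 2 * (u.filter fun i => (ofLex i).2 = 0).card = 2 * M
  · have hs' := (sector_iff M s).1 hs
    have hu' := (sector_iff M u).1 hu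
    rw [locPinch_apply_of_card_eq hA (hs'.1.trans hu'.1.symm) (hs'.2.trans hu'.2.symm)]
  · rw [(hJ t u ht hu).2, mul_zero, mul_zero]

/-- **Local sector indicators are even local observables**: the indicator of "`a` electrons of spin `σ` on the sites of `X`" is
`Σ_{T ⊆ X, |T| = a} Π_{x∈T} n_{xσ} · Π_{x∈X∖T} (1 − n_{xσ})`, a polynomial in densities of `X`. [folklore] -/
theorem diagonal_spinCount_indicator_mem (X : Finset Λ) (σ : Fin 2) (a : ℕ) :
    (diagonal fun s : Finset (Orb Λ) =>
        if ((univ.filter fun x : Λ => orb x σ ∈ s) ∩ X).card = a then (1 : ℂ) else 0) ∈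
      carEvenSubalgebra (orbSet X) := by
  -- work in the COMMUTATIVE algebra of diagonal symbols and push forward along `diagonal`
  set φ := Matrix.diagonalAlgHom (n := Finset (Orb Λ)) (R := ℂ) (α := ℂ) with hφ
  have hχ : ∀ x ∈ X, (fun s : Finset (Orb Λ) => if orb x σ ∈ s then (1 : ℂ) else 0) ∈
      (carEvenSubalgebra (orbSet X)).comap φ := by
    intro x hx
    rw [Subalgebra.mem_comap, Matrix.diagonalAlgHom_apply, ← numberAt_eq_diagonal]
    exact creation_mul_annihilation_mem_carEvenSubalgebra (mem_orbSet.2 hx) (mem_orbSet.2 hx)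
  have hpt : (fun s : Finset (Orb Λ) =>
        if ((univ.filter fun x : Λ => orb x σ ∈ s) ∩ X).card = a then (1 : ℂ) else 0) =
      ∑ T ∈ X.powersetCard a, (∏ x ∈ T, fun s : Finset (Orb Λ) => if orb x σ ∈ s then (1 : ℂ) else 0) *
        ∏ x ∈ X \ T, (1 - fun s : Finset (Orb Λ) => if orb x σ ∈ s then (1 : ℂ) else 0) := by
    funext s
    simp only [Finset.sum_apply, Pi.mul_apply, Finset.prod_apply, Pi.sub_apply, Pi.one_apply]
    set W : Finset Λ := (univ.filter fun x : Λ => orb x σ ∈ s) ∩ X with hW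
    have hWmem : ∀ x, x ∈ W ↔ orb x σ ∈ s ∧ x ∈ X := fun x => by simp [hW]
    have hval_ne : ∀ T ∈ X.powersetCard a, T ≠ W →
        (∏ x ∈ T, if orb x σ ∈ s then (1 : ℂ) else 0) *
          ∏ x ∈ X \ T, (1 - if orb x σ ∈ s then (1 : ℂ) else 0) = 0 := by
      intro T hT hne
      have hTX : T ⊆ X := (Finset.mem_powersetCard.1 hT).1
      by_cases hall : ∀ x ∈ T, orb x σ ∈ s
      · have hTW : T ⊆ W := fun x hx => (hWmem x).2 ⟨hall x hx, hTX hx⟩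
        obtain ⟨x, hxW, hxT⟩ := Finset.exists_of_ssubset (lt_of_le_of_ne hTW hne)
        refine mul_eq_zero_of_right _ (Finset.prod_eq_zero (Finset.mem_sdiff.2 ⟨((hWmem x).1 hxW).2, hxT⟩) ?_)
        rw [if_pos ((hWmem x).1 hxW).1, sub_self]
      · push Not at hall
        obtain ⟨x, hxT, hxs⟩ := hall
        exact mul_eq_zero_of_left (Finset.prod_eq_zero hxT (by rw [if_neg hxs])) _
    by_cases ha : W.card = a
    · have hWa : W ∈ X.powersetCard a := Finset.mem_powersetCard.2 ⟨Finset.inter_subset_right, ha⟩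
      rw [if_pos ha, Finset.sum_eq_single_of_mem W hWa fun T hT hne => hval_ne T hT hne,
        Finset.prod_eq_one fun x hx => by rw [if_pos ((hWmem x).1 hx).1],
        Finset.prod_eq_one fun x hx => ?_, one_mul]
      obtain ⟨hxX, hxW⟩ := Finset.mem_sdiff.1 hx
      rw [if_neg (fun h => hxW ((hWmem x).2 ⟨h, hxX⟩)), sub_zero]
    · rw [if_neg ha]
      refine (Finset.sum_eq_zero fun T hT => hval_ne T hT fun h => ha ?_).symm
      rw [← h]
      exact (Finset.mem_powersetCard.1 hT).2
  have hF : (fun s : Finset (Orb Λ) =>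
        if ((univ.filter fun x : Λ => orb x σ ∈ s) ∩ X).card = a then (1 : ℂ) else 0) ∈
      (carEvenSubalgebra (orbSet X)).comap φ := by
    rw [hpt]
    refine Subalgebra.sum_mem _ fun T hT => Subalgebra.mul_mem _ (Subalgebra.prod_mem _ fun x hx => ?_)
      (Subalgebra.prod_mem _ fun x hx => ?_)
    · exact hχ x ((Finset.mem_powersetCard.1 hT).1 hx)
    · exact Subalgebra.sub_mem _ (Subalgebra.one_mem _) (hχ x (Finset.mem_sdiff.1 hx).1)
  rw [Subalgebra.mem_comap, Matrix.diagonalAlgHom_apply] at hF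
  exact hF

/-- **The local sector projections `Π_q = 1[(N↑_X, N↓_X) = q]` are even local observables of the window.** [folklore] -/
theorem sectorProj_locGrade_mem (X : Finset Λ) (q : ℕ × ℕ) :
    Literature.LinearAlgebra.Matrix.sectorProj (R := ℂ) (fun s : Finset (Orb Λ) => ((upPart s ∩ X).card, (downPart s ∩ X).card)) q ∈ carEvenSubalgebra (orbSet X) := by
  have h : Literature.LinearAlgebra.Matrix.sectorProj (R := ℂ) (fun s : Finset (Orb Λ) => ((upPart s ∩ X).card, (downPart s ∩ X).card)) q =
      (diagonal fun s : Finset (Orb Λ) =>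
          if ((univ.filter fun x : Λ => orb x 0 ∈ s) ∩ X).card = q.1 then (1 : ℂ) else 0) *
        diagonal fun s : Finset (Orb Λ) =>
          if ((univ.filter fun x : Λ => orb x 1 ∈ s) ∩ X).card = q.2 then (1 : ℂ) else 0 := by
    rw [diagonal_mul_diagonal]
    unfold Literature.LinearAlgebra.Matrix.sectorProj
    congr 1
    funext s
    simp only [upPart, downPart, Prod.ext_iff]
    split_ifs <;> simp_all
  rw [h]
  exact Subalgebra.mul_mem _ (diagonal_spinCount_indicator_mem X 0 q.1) (diagonal_spinCount_indicator_mem X 1 q.2)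

/-- **The pinched observable `A₀` is again an even local observable of the window.** [folklore] -/
theorem locPinch_mem {X : Finset Λ} {A : Matrix (Finset (Orb Λ)) (Finset (Orb Λ)) ℂ}
    (hA : A ∈ carEvenSubalgebra (orbSet X)) : gradedCompress (fun s : Finset (Orb Λ) => ((upPart s ∩ X).card, (downPart s ∩ X).card)) A ∈ carEvenSubalgebra (orbSet X) := by
  rw [gradedCompress_eq_sum_sectorProj]
  exact Subalgebra.sum_mem _ fun q _ =>
    Subalgebra.mul_mem _ (Subalgebra.mul_mem _ (sectorProj_locGrade_mem X q) hA) (sectorProj_locGrade_mem X q)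

/-- **An even observable of the EMPTY window acts as a scalar** (`𝔄_even(orbSet ∅) = ⊥`). [folklore] -/
theorem exists_mul_eq_smul_of_mem_carEvenSubalgebra_orbSet_empty {A : Matrix (Finset (Orb Λ)) (Finset (Orb Λ)) ℂ}
    (hA : A ∈ carEvenSubalgebra (orbSet (∅ : Finset Λ))) :
    ∃ c : ℂ, ∀ B : Matrix (Finset (Orb Λ)) (Finset (Orb Λ)) ℂ, A * B = c • B := by
  have hgen : carEvenGenerators (orbSet (∅ : Finset Λ)) = ∅ := by
    ext M
    simp only [carEvenGenerators, Set.mem_setOf_eq, Set.mem_empty_iff_false, iff_false]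
    rintro ⟨l, l', hl, -, -⟩
    rw [mem_orbSet] at hl
    exact Finset.notMem_empty _ hl
  have hbot : carEvenSubalgebra (orbSet (∅ : Finset Λ)) = ⊥ := by
    rw [carEvenSubalgebra, hgen, Algebra.adjoin_empty]
  rw [hbot, Algebra.mem_bot] at hA
  obtain ⟨c, rfl⟩ := Set.mem_range.1 hA
  exact ⟨c, fun B => by rw [Algebra.algebraMap_eq_smul_one, smul_one_mul]⟩

/-- Sector compression commutes with scalars. [folklore] -/
theorem toBlock_smul_eq {m : Type*} (c : ℂ) (M : Matrix m m ℂ) (p : m → Prop) :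
    (c • M).toBlock p p = c • M.toBlock p p := rfl

/-! The operator norm of the pinching. The `DecidableEq (Finset (Orb Λ))` instance entering the `ℓ²`-operator norm is a
BINDER here, so that at the torus the lemma is read with the tree's shortcut instance `instDecidableEqFinsetOrbFermionTorus`
(the instance the line's `‖A‖` carries). -/

/-- **Norm of the pinching**: at most `(|X|+1)²` local sectors occur and each `Π_q` has norm `≤ 1`, so
`‖A₀‖ ≤ (|X|+1)² ‖A‖` (crude; the sharp pinching bound `‖A₀‖ ≤ ‖A‖` is not needed). [folklore] -/
theorem norm_locPinch_le [DecidableEq (Finset (Orb Λ))] (X : Finset Λ) (A : Matrix (Finset (Orb Λ)) (Finset (Orb Λ)) ℂ) :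
    ‖gradedCompress (fun s : Finset (Orb Λ) => ((upPart s ∩ X).card, (downPart s ∩ X).card)) A‖ ≤ ((X.card : ℝ) + 1) ^ 2 * ‖A‖ := by
  have hP : ∀ q : ℕ × ℕ, ‖(Literature.LinearAlgebra.Matrix.sectorProj (R := ℂ) (fun s : Finset (Orb Λ) => ((upPart s ∩ X).card, (downPart s ∩ X).card)) q)‖ ≤ 1 := by
    intro q
    unfold Literature.LinearAlgebra.Matrix.sectorProj
    rw [Matrix.l2_opNorm_diagonal]
    refine (pi_norm_le_iff_of_nonneg zero_le_one).2 fun s => ?_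
    split_ifs <;> simp
  have hcardS : ((Finset.univ : Finset (Finset (Orb Λ))).image (fun s : Finset (Orb Λ) => ((upPart s ∩ X).card, (downPart s ∩ X).card))).card ≤ (X.card + 1) ^ 2 := by
    calc _ ≤ (Finset.range (X.card + 1) ×ˢ Finset.range (X.card + 1)).card := by
          refine Finset.card_le_card fun q hq => ?_
          obtain ⟨s, -, rfl⟩ := Finset.mem_image.1 hq
          simp only [Finset.mem_product, Finset.mem_range]
          exact ⟨Nat.lt_succ_of_le (Finset.card_le_card Finset.inter_subset_right),
            Nat.lt_succ_of_le (Finset.card_le_card Finset.inter_subset_right)⟩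
      _ = (X.card + 1) ^ 2 := by rw [Finset.card_product, Finset.card_range, sq]
  rw [gradedCompress_eq_sum_sectorProj]
  calc ‖∑ q ∈ (Finset.univ : Finset (Finset (Orb Λ))).image (fun s : Finset (Orb Λ) => ((upPart s ∩ X).card, (downPart s ∩ X).card)),
          Literature.LinearAlgebra.Matrix.sectorProj (R := ℂ) (fun s : Finset (Orb Λ) => ((upPart s ∩ X).card, (downPart s ∩ X).card)) q * A *
            Literature.LinearAlgebra.Matrix.sectorProj (R := ℂ) (fun s : Finset (Orb Λ) => ((upPart s ∩ X).card, (downPart s ∩ X).card)) q‖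
        ≤ ∑ q ∈ (Finset.univ : Finset (Finset (Orb Λ))).image (fun s : Finset (Orb Λ) => ((upPart s ∩ X).card, (downPart s ∩ X).card)),
          ‖Literature.LinearAlgebra.Matrix.sectorProj (R := ℂ) (fun s : Finset (Orb Λ) => ((upPart s ∩ X).card, (downPart s ∩ X).card)) q * A *
            Literature.LinearAlgebra.Matrix.sectorProj (R := ℂ) (fun s : Finset (Orb Λ) => ((upPart s ∩ X).card, (downPart s ∩ X).card)) q‖ := norm_sum_le _ _
    _ ≤ ∑ q ∈ (Finset.univ : Finset (Finset (Orb Λ))).image (fun s : Finset (Orb Λ) => ((upPart s ∩ X).card, (downPart s ∩ X).card)), ‖A‖ := by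
        refine Finset.sum_le_sum fun q _ => ?_
        have h1 := hP q
        calc _ ≤ ‖Literature.LinearAlgebra.Matrix.sectorProj (R := ℂ) (fun s : Finset (Orb Λ) => ((upPart s ∩ X).card, (downPart s ∩ X).card)) q * A‖ *
              ‖Literature.LinearAlgebra.Matrix.sectorProj (R := ℂ) (fun s : Finset (Orb Λ) => ((upPart s ∩ X).card, (downPart s ∩ X).card)) q‖ := norm_mul_le _ _
          _ ≤ (‖Literature.LinearAlgebra.Matrix.sectorProj (R := ℂ) (fun s : Finset (Orb Λ) => ((upPart s ∩ X).card, (downPart s ∩ X).card)) q‖ * ‖A‖) *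
              ‖Literature.LinearAlgebra.Matrix.sectorProj (R := ℂ) (fun s : Finset (Orb Λ) => ((upPart s ∩ X).card, (downPart s ∩ X).card)) q‖ := by
              gcongr; exact norm_mul_le _ _
          _ ≤ (1 * ‖A‖) * 1 := by gcongr
          _ = ‖A‖ := by ring
    _ = (((Finset.univ : Finset (Finset (Orb Λ))).image (fun s : Finset (Orb Λ) => ((upPart s ∩ X).card, (downPart s ∩ X).card))).card : ℝ) * ‖A‖ := by
        rw [Finset.sum_const, nsmul_eq_mul]
    _ ≤ ((X.card : ℝ) + 1) ^ 2 * ‖A‖ := by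
        gcongr
        exact_mod_cast hcardS

end Generic

end Summit.Ventures.CertifiedManyBodySolver.Theorems.TcThermcert1.LocalChargePinching

end
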